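import Summits.BirchSwinnertonDyer.BirchSwinnertonDyer.Theorems.PrintCFramBottomClassIndexLawFiveLeHerbrandOddClassGroupHom
import Summits.BirchSwinnertonDyer.BirchSwinnertonDyer.Theorems.PrintCFramBottomClassIndexLawFiveLeHerbrandRationalTransport
import HarnessLib

/-!
# Route `PrintCFram`, crux C2 `BottomClassIndexLawFiveLe` (stmt-BirchSwinnertonDyer-20372), line `eisenstein-resource-bdp-line`
# v12 (LEAD g9, Road C «conjugation swap»): REGISTERED STUB O `stub_oddVanishing_of_mazurWiles` — BY NAME AND SIGNATURE
# (cell `bsd-print-cfram`, seat `bsd-line-cfram-p1-w6` g0; `--supports` 20372; 0 facts, 0 defs)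

HONEST FRAMING. Nothing about BSD is proved here; no summit statement is proved by this seat. This file proves the registered stub O of
the v12 skeleton (`Cruxes/BottomClassIndexLawFiveLe/Lines/eisenstein_resource_bdp_line.lean` §1, commit 90caf660d910) VERBATIM: for an odd
prime `p`, an abelian number field `L` with `p ∤ [L:ℚ]`, `r₁ : Γ_ℚ → 𝔽_pˣ` whose lift `ψ₁ : Gal(L/ℚ) → ℤ_pˣ` (`ψ₁(τ̄) mod p = r₁(τ)`) has a
primitive odd Dirichlet avatar `χ₁` (`ψ₁(τ̄) = χ₁(χ_{f₁}(τ))`) with `‖B_{1,χ₁⁻¹}‖_p = 1`, and ASSUMING Mazur–Wiles Thm. 2 (the antecedent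
`MazurWiles1984.thm2_oddChiPart_classGroup_card_eq_pow_val_bernoulli`, an unproved named fact — the stub is an implication FROM it):
every `G : Γ_ℚ → 𝔽_p`, continuous and additive on `N = res(Γ_L)`, `r₁`-isotypic under `Γ_ℚ` and killing `N ∩ I_𝔓` for every prime `𝔓` of
`\bar ℤ`, vanishes on `N`. It is `HerbrandOddClassGroup.oddVanish_range_final` (p656104, here unfolded into its two constituents) with `φ := ψ₁ ∘ absGaloisQuot ℚ L` (trivial on
`res(Γ_L)` by `absGaloisQuot_absGaloisRestrict`); the registered hypothesis «`χ₁ ≠ ω`» is not needed (it follows from `‖B_{1,χ₁⁻¹}‖ = 1`,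
w3 g4) and is ignored. Engine: Hilbert class field (p654556) + Frobenius equivariance (p654872) + Mazur–Wiles F1ᵈ (p648615/p652301/
p650417–p653451/p655378) + the `Γ_ℚ ↔ Γ_L` transport of w4 g5 (p655726).

THEOREMS ONLY; no definition, no named fact, no `sorry`; imports no `Theses` module.
References: [MazurWiles1984] Thm. 2 (p. 216) via [Solomon1990] pp. 467–468; [Lang1990] Ch. 1 §3; [Gross1980] Lemma 22.3.4 (1);
[NeukirchANT1999] Ch. VI §6–§7.
-/

set_option autoImplicit false
-- `…BirchSwinnertonDyer.BirchSwinnertonDyer.Theorems…` is the problem's mandated namespace (D-0017).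
set_option linter.dupNamespace false

noncomputable section

open NumberField Field IsDedekindDomain
open Literature.NumberTheory.GaloisRepresentations Literature.NumberTheory.NumberFields
open Literature.NumberTheory.EllipticCurves Literature.NumberTheory.LFunctions

namespace Summit.BirchSwinnertonDyer.BirchSwinnertonDyer.Theorems.PrintCFram.HerbrandOddClassGroup

/-- **Registered stub O of line `eisenstein-resource-bdp-line` v12 (`stub_oddVanishing_of_mazurWiles`), verbatim.** Mazur–Wiles Thm. 2
⟹ the odd vanishing `ODD(r₁, res(Γ_L))`: see the module docstring. [cite: MazurWiles1984, Thm. 2 (p. 216) — via Solomon1990, §I pp. 467–468]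
[cite: Lang1990, Ch. 1 §3 Thm. 3.1, Cor. 3] [cite: NeukirchANT1999, Ch. VI §7 Thm. (7.1)] -/
theorem stub_oddVanishing_of_mazurWiles :
    Literature.NumberTheory.NumberFields.MazurWiles1984.thm2_oddChiPart_classGroup_card_eq_pow_val_bernoulli →
    ∀ (p : ℕ) [Fact p.Prime], p ≠ 2 →
    ∀ (L : Type) [Field L] [NumberField L] [IsAbelianGalois ℚ L], ¬ p ∣ Module.finrank ℚ L →
    ∀ (r₁ : absoluteGaloisGroup ℚ →* (ZMod p)ˣ) (ψ₁ : (L ≃ₐ[ℚ] L) →* ℤ_[p]ˣ),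
      (∀ τ : absoluteGaloisGroup ℚ,
        PadicInt.toZMod ((ψ₁ (absGaloisQuot ℚ L τ) : ℤ_[p]ˣ) : ℤ_[p]) = ((r₁ τ : (ZMod p)ˣ) : ZMod p)) →
    ∀ (f₁ : ℕ) [NeZero f₁] (χ₁ : DirichletCharacter ℚ_[p] f₁), χ₁.IsPrimitive → χ₁.Odd →
      (¬ ∀ a : ℤ, ¬ ((p : ℤ) ∣ a) → ‖χ₁ (a : ZMod f₁) - (a : ℚ_[p])‖ < 1) →
      (∀ τ : absoluteGaloisGroup ℚ,
        (((ψ₁ (absGaloisQuot ℚ L τ) : ℤ_[p]ˣ) : ℤ_[p]) : ℚ_[p]) =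
          χ₁ ((modNCyclotomicCharacter ℚ f₁ τ : (ZMod f₁)ˣ) : ZMod f₁)) →
      ‖KrizLi2019.bernoulliOnePrim χ₁⁻¹‖ = 1 →
    ∀ G : absoluteGaloisGroup ℚ → ZMod p, (Continuous fun n : (absGaloisRestrict ℚ L).range => G n) →
      (∀ a ∈ (absGaloisRestrict ℚ L).range, ∀ b ∈ (absGaloisRestrict ℚ L).range, G (a * b) = G a + G b) →
      (∀ g : absoluteGaloisGroup ℚ, ∀ n ∈ (absGaloisRestrict ℚ L).range, G (g * n * g⁻¹) = ((r₁ g : (ZMod p)ˣ) : ZMod p) * G n) →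
      (∀ (ℓ : HeightOneSpectrum (𝓞 ℚ)) (𝔓 : Ideal (absIntegers (𝓞 ℚ) ℚ)), 𝔓 ∈ ℓ.primesAbove →
        ∀ n ∈ (absGaloisRestrict ℚ L).range, n ∈ 𝔓.inertia (absoluteGaloisGroup ℚ) → G n = 0) →
      ∀ n ∈ (absGaloisRestrict ℚ L).range, G n = 0 := by
  intro hMW p _ hp2 L _ _ _ hpL r₁ ψ₁ hr₁ψ₁ f₁ _ χ₁ hprim₁ hodd₁ _ hψχ₁ hB₁ G hGc hadd hconj hI
  haveI : NeZero p := ⟨(Fact.out : p.Prime).ne_zero⟩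
  -- `ODD(r₁, res(Γ_L)) ⟸ ODD_L(r₁)` (w4 g5's transport) `⟸` Hilbert class field + Mazur–Wiles (`absGaloisHom_eq_one_final`),
  -- with `φ := ψ₁ ∘ absGaloisQuot ℚ L`, trivial on `res(Γ_L)`; this is `oddVanish_range_final` of `…HerbrandOddVanishing` unfolded.
  exact HerbrandSelmerToHom.oddVanishQ_of_forall_character_field r₁
    (fun κ hκ heq hunr => absGaloisHom_eq_one_final hMW hp2 hpL hprim₁ hodd₁ (ψ₁.comp (absGaloisQuot ℚ L))
      (fun σ => by rw [MonoidHom.comp_apply, absGaloisQuot_absGaloisRestrict, map_one]) hψχ₁ hB₁ r₁ hr₁ψ₁ κ hκ hunr heq)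
    G hGc hadd hconj hI

end Summit.BirchSwinnertonDyer.BirchSwinnertonDyer.Theorems.PrintCFram.HerbrandOddClassGroup

end
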